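import Literature.AnabelianGeometry.SemiGraphs.TemperedFixedSystemOfFiniteFibres
import Literature.AnabelianGeometry.SemiGraphs.TreeSystemFixedPointTopological
import Literature.AnabelianGeometry.SemiGraphs.FreeGroupsAndActionsProofs2
import Literature.AnabelianGeometry.SemiGraphs.SubdivisionLemmas
import Mathlib.Combinatorics.SimpleGraph.Metric
import HarnessLib

/-!
# [SemiAnbd] Thm 3.7 (iii) beyond finite `𝔾`: the base images of the fixed locus (G2·R1-temp, tempered half of «escape needs a ray»)

Mochizuki, *Semi-graphs of anabelioids*, Publ. RIMS **42** (2006), §3, Theorem 3.7 (iii), manuscript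
p. 41 ("`H` always fixes at least one vertex of `𝒢_{∞,i}`"; "natural maps `V_i → V_j`")
[cite: MochizukiSemiAnbd2006, Thm 3.7(iii) p.41]; the author's *Comments* (2020), item (6).

PROOF-ONLY (cell abc-iut, layer L3, GAP row G-t6g3-2b «no escape», sub-row **G2·R1-temp** = the
TEMPERED half of route (R1) «horizontal escape needs a ray», L3-lead rulings α47 (2)/α48 (3); seat
abc-iut-w4-d080; no definition, no new named fact).  For the level data `D : VerticialLevelData 𝒢 c` of a
chart (any countable `𝒢`; at the canonical Galois tower by abc-iut-L3-t8's instance) and a COMPACT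
subgroup `C`, write — inline, no definition —

  `B j := (D.proj j).vertexMap '' {x : Vert(D.tree j) | C fixes x} ⊆ Vert(𝔾)`

for the BASE IMAGE of the `C`-fixed locus of the tree `D.tree j`.  This file proves the three structural
facts that make `(B j)_j` an input of abc-iut-w5-d189's generic ends piece (GEN-ENDS (a): nested connected
nonempty vertex sets with empty intersection contain a ray), and the dichotomy that routes the
horizontal/vertical cases of the open core:

* `VerticialLevelData.fixedLocus_nonempty` — print's "`H` always fixes at least one vertex of
  `𝒢_{∞,i}`": a compact `C` acts on `D.tree j` through a finite quotient (open kernel), over `𝔾` (no branch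
  switching), so it fixes a vertex (abc-iut-L3-t6's `SemiGraph.exists_fixed_vertex_of_isCompact_over`);
  hence `baseFixedImage_nonempty`;
* `VerticialLevelData.baseFixedImage_antitone` — `i ≤ j ⇒ B j ⊆ B i` (the transition maps are over `𝔾`
  and equivariant);
* `VerticialLevelData.baseFixedImage_joined` — any two vertices of `B j` are joined by a walk of the
  subdivision of `𝔾` all of whose VERTEX-nodes lie in `B j` (the fixed locus of `C` in a tree is
  path-closed — abc-iut-L3-t11's `SemiGraph.nodeMap_eq_self_of_isPath` on the unique tree path — and
  walks push down along `D.proj j`);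
* `VerticialLevelData.persistent_or_escape` — EITHER some base vertex `v` lies in every `B j`
  («persistent base vertex»: then the hypothesis `hne` of abc-iut-w4-d080's `hfix_of_finite_fixed_over`
  holds verbatim, and `hfix` follows from finiteness of the fixed fibres over `v` — sub-row G2·E1-V), OR
  `⋂_j B j = ∅` («horizontal escape»: with the three facts above, GEN-ENDS (a) yields a ray of `𝔾`
  eventually inside every `B j` — a "`C`-fixed end").

RECORDED, NOT CLAIMED (SHAPES-Ggt6g32.md §(f), route (R1); desk analysis of this seat): in the ESCAPE
branch a "`C`-fixed end" `r₀ r₁ r₂ …` yields, at every level `j`, `C`-fixed tree vertices over all `r_k`,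
`k ≥ k(j)`, joined through the fixed locus; when `𝔾` is tree-shaped the joining tree paths even cross the
ray edges, so `C` fixes tree EDGES over every `r_k r_{k+1}`, `k ≥ k(j)`, and — at the last exit of such a
path from `r_k` — a `C`-fixed tree BRANCH-PAIR at a vertex over `r_k`.  But `k(j) → ∞` IS the escape: over
any FIXED base vertex the fixed data disappear at high levels, whereas the estrangement kill
(`TemperedTreeBranchPairEstrangement.lean`, abc-iut-L3-t10's kill file) consumes a COMPATIBLE branch-pair
system over ONE base vertex.  So an escaping compact `C ≠ 1` evades the (I4′)-mechanism as it stands; the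
sub-row R1b («can a compact `C ≠ 1` escape at all?») is OPEN (desk), and nothing in this file claims it.
At abc-iut-w4-d075's `𝒢⋆` (`H = ⟨x⟩`): `B j = {v} ∪ {w_n : n ≥ m(j)}`, `⋂_j B j = {v}` — the persistent
branch; nothing false is asserted there.  Nothing here
bears on [IUTchIII] Cor. 3.12.
-/

namespace Literature.AnabelianGeometry.SemiGraphs

namespace ProfiniteSemiGraph

namespace VerticialLevelData

open CategoryTheory Topology

universe v u

variable {𝒢 : ProfiniteSemiGraph.{u}} {c : TemperedPiChart 𝒢} (D : VerticialLevelData.{v} 𝒢 c)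

/-! ### The fixed locus is nonempty at every level -/

/-- **"`H` always fixes at least one vertex of `𝒢_{∞,i}`"** (print p. 41): a COMPACT subgroup `C` of
`π₁^temp(𝒢)` fixes a vertex of every tree of the level data — it acts through a finite quotient
(`D.isOpen_ker`), over `𝔾` (`D.act_over`, so without switching branches), on a tree with a vertex
(abc-iut-L3-t6's `SemiGraph.exists_fixed_vertex_of_isCompact_over`, Lemma 1.8 (ii)(a)).
[cite: MochizukiSemiAnbd2006, Thm 3.7(iii) p.41] -/
theorem fixedLocus_nonempty (C : Subgroup c.G) (hC : IsCompact (C : Set c.G)) (j : D.J) :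
    ∃ x : (D.tree j).Vertex, ∀ g ∈ C, (D.act j g).hom.vertexMap x = x := by
  haveI : IsTopologicalGroup c.G := c.isTopologicalGroup
  obtain ⟨x, hx⟩ := SemiGraph.exists_fixed_vertex_of_isCompact_over C hC (D.isTree j) (D.vertex j)
    (D.proj j) (D.act j) (D.isOpen_ker j) (D.act_over j)
  exact ⟨x, fun g hg => hx ⟨g, hg⟩⟩

/-- **The base image `B j` of the fixed locus is nonempty** at every level (for compact `C`).
[cite: MochizukiSemiAnbd2006, Thm 3.7(iii) p.41] -/
theorem baseFixedImage_nonempty (C : Subgroup c.G) (hC : IsCompact (C : Set c.G)) (j : D.J) :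
    ((D.proj j).vertexMap '' {x : (D.tree j).Vertex | ∀ g ∈ C, (D.act j g).hom.vertexMap x = x}).Nonempty :=
  let ⟨x, hx⟩ := D.fixedLocus_nonempty C hC j
  ⟨(D.proj j).vertexMap x, x, hx, rfl⟩

/-! ### The base images are nested -/

/-- **`B j ⊆ B i` for `i ≤ j`** ("natural maps `V_i → V_j`", p. 41): the transition map `D.trans h`
carries a `C`-fixed vertex of `D.tree j` to a `C`-fixed vertex of `D.tree i` (equivariance, `trans_act`) with
the same image in `𝔾` (`trans_over`). [cite: MochizukiSemiAnbd2006, Thm 3.7(iii) p.41] -/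
theorem baseFixedImage_antitone (C : Subgroup c.G) ⦃i j : D.J⦄ (h : i ≤ j) :
    (D.proj j).vertexMap '' {x : (D.tree j).Vertex | ∀ g ∈ C, (D.act j g).hom.vertexMap x = x} ⊆
      (D.proj i).vertexMap '' {x : (D.tree i).Vertex | ∀ g ∈ C, (D.act i g).hom.vertexMap x = x} := by
  rintro _ ⟨x, hx, rfl⟩
  refine ⟨(D.trans h).vertexMap x, fun g hg => ?_, ?_⟩
  · rw [← D.trans_act_vertexMap h g x, hx g hg]
  · have e := congrArg (fun φ => SemiGraph.Hom.vertexMap φ x) (D.trans_over h)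
    simpa only [SemiGraph.comp_vertexMap, Function.comp_apply] using e

/-! ### The base images are joined (connected through themselves) -/

/-- **Any two vertices of `B j` are joined by a walk of the subdivision of `𝔾` whose vertex-nodes all lie
in `B j`.**  The two vertices are images of `C`-fixed tree vertices `x`, `x'`; the tree path from `x` to
`x'` consists of `C`-fixed nodes (an automorphism fixing the end-points of a PATH of an acyclic graph fixes
it pointwise — abc-iut-L3-t11's `SemiGraph.nodeMap_eq_self_of_isPath`, Lemma 1.8 (ii)(b)); its image under
`D.proj j` (a morphism of semi-graphs induces a graph homomorphism of subdivisions, `subdivision_adj_map`)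
is the required walk. [cite: MochizukiSemiAnbd2006, Thm 3.7(iii) p.41] -/
theorem baseFixedImage_joined (C : Subgroup c.G) (j : D.J) {u u' : 𝒢.graph.Vertex}
    (hu : u ∈ (D.proj j).vertexMap '' {x : (D.tree j).Vertex | ∀ g ∈ C, (D.act j g).hom.vertexMap x = x})
    (hu' : u' ∈ (D.proj j).vertexMap '' {x : (D.tree j).Vertex | ∀ g ∈ C, (D.act j g).hom.vertexMap x = x}) :
    ∃ p : 𝒢.graph.subdivision.Walk (Sum.inl u) (Sum.inl u'), ∀ w : 𝒢.graph.Vertex, Sum.inl w ∈ p.support →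
      w ∈ (D.proj j).vertexMap '' {x : (D.tree j).Vertex | ∀ g ∈ C, (D.act j g).hom.vertexMap x = x} := by
  classical
  obtain ⟨x, hx, rfl⟩ := hu
  obtain ⟨x', hx', rfl⟩ := hu'
  -- the tree path between the two fixed vertices is pointwise fixed
  have hA : (D.tree j).subdivision.IsAcyclic := (D.isTree j).isTree.isAcyclic
  obtain ⟨q, hq⟩ := (D.isTree j).isTree.connected.exists_isPath (Sum.inl x) (Sum.inl x')
  have fixq : ∀ z ∈ q.support, ∀ g ∈ C, SemiGraph.nodeMap (D.act j g) z = z := fun z hz g hg =>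
    SemiGraph.nodeMap_eq_self_of_isPath hA (D.act j g) (by simp [SemiGraph.nodeMap, hx g hg])
      (by simp [SemiGraph.nodeMap, hx' g hg]) q hq z hz
  -- push the path down along `proj j`
  let Φ : (D.tree j).subdivision →g 𝒢.graph.subdivision :=
    ⟨Sum.map (D.proj j).vertexMap (Sum.map (D.proj j).edgeMap (D.proj j).branchMap),
      fun h => SemiGraph.subdivision_adj_map (D.proj j) h⟩
  refine ⟨q.map Φ, fun w hw => ?_⟩
  have hw' : Sum.inl w ∈ q.support.map ⇑Φ := by
    rw [← SimpleGraph.Walk.support_map]; exact hw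
  obtain ⟨z, hz, hzw⟩ := List.mem_map.mp hw'
  -- a node mapping to a vertex-node is a vertex-node
  obtain ⟨y, rfl⟩ : ∃ y : (D.tree j).Vertex, z = Sum.inl y := by
    rcases z with y | e
    · exact ⟨y, rfl⟩
    · simp [Φ] at hzw
  refine ⟨y, fun g hg => ?_, ?_⟩
  · have h1 := fixq _ hz g hg
    simpa [SemiGraph.nodeMap] using h1
  · simpa [Φ] using hzw

/-! ### The dichotomy: persistent base vertex or horizontal escape -/

/-- **Persistent base vertex OR horizontal escape.**  Either some vertex `v` of `𝔾` lies in every base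
image `B j` — and then, VERBATIM, the hypothesis `hne` of `hfix_of_finite_fixed_over` holds at `v`
(sub-row G2·E1-V: `hfix` follows from the finiteness of the `C`-fixed fibres over `v`) — or every vertex
eventually leaves the `B j`, i.e. `⋂_j B j = ∅` (with `baseFixedImage_nonempty/antitone/joined`, the input
of abc-iut-w5-d189's GEN-ENDS (a): a ray of `𝔾` eventually inside every `B j`, a "`C`-fixed end").
[cite: MochizukiSemiAnbd2006, Thm 3.7(iii) p.41] -/
theorem persistent_or_escape (C : Subgroup c.G) :
    (∃ v : 𝒢.graph.Vertex, ∀ j, ∃ x : (D.tree j).Vertex, (D.proj j).vertexMap x = v ∧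
        ∀ g ∈ C, (D.act j g).hom.vertexMap x = x) ∨
      ∀ v : 𝒢.graph.Vertex, ∃ j, v ∉ (D.proj j).vertexMap ''
        {x : (D.tree j).Vertex | ∀ g ∈ C, (D.act j g).hom.vertexMap x = x} := by
  by_cases h : ∃ v : 𝒢.graph.Vertex, ∀ j, v ∈ (D.proj j).vertexMap ''
      {x : (D.tree j).Vertex | ∀ g ∈ C, (D.act j g).hom.vertexMap x = x}
  · obtain ⟨v, hv⟩ := h
    refine Or.inl ⟨v, fun j => ?_⟩
    obtain ⟨x, hx, hxv⟩ := hv j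
    exact ⟨x, hxv, hx⟩
  · push Not at h
    exact Or.inr h

/-- **The persistent branch closes `hfix` modulo finite fixed fibres** (G2·E1-V, abc-iut-w4-d080's
`hfix_of_finite_fixed_over`, restated on the base images): a vertex `v` in every `B j` over which only
finitely many tree vertices are fixed at every level gives a compatible `C`-fixed vertex system.
[cite: MochizukiSemiAnbd2006, Thm 3.7(iii) p.41] -/
theorem hfix_of_persistent_of_finite_fibres (C : Subgroup c.G) (v : 𝒢.graph.Vertex)
    (hv : ∀ j, v ∈ (D.proj j).vertexMap '' {x : (D.tree j).Vertex | ∀ g ∈ C, (D.act j g).hom.vertexMap x = x})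
    (hfin : ∀ j, {x : (D.tree j).Vertex | (D.proj j).vertexMap x = v ∧
      ∀ g ∈ C, (D.act j g).hom.vertexMap x = x}.Finite) :
    ∃ x : ∀ j, (D.tree j).Vertex, (∀ ⦃i j : D.J⦄ (h : i ≤ j), (D.trans h).vertexMap (x j) = x i) ∧
      ∀ g ∈ C, ∀ j, (D.act j g).hom.vertexMap (x j) = x j :=
  D.hfix_of_finite_fixed_over C v (fun j => let ⟨x, hx, hxv⟩ := hv j; ⟨x, hxv, hx⟩) hfin

/-! ### Link with the displacement bound of the closer -/

/-- **A compatible fixed system has zero displacement**: if `hfix` holds for `C` then t10's closer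
hypothesis `hdisp` (pointwise bounded displacement along some compatible system) holds for `C` with the
bound `0`.  Contrapositively: the FAILURE of `hdisp` for a compact `C ≠ 1` forces, by `persistent_or_escape`
and `hfix_of_persistent_of_finite_fibres`, either horizontal escape (`⋂_j B j = ∅`) or a persistent base
vertex with INFINITELY many fixed tree vertices over it at some level (the vertical/torsor regime).
[cite: MochizukiSemiAnbd2006, Thm 3.7(iii) p.41] -/
theorem hdisp_of_hfix (C : Subgroup c.G) (x : ∀ j, (D.tree j).Vertex)
    (hx : ∀ ⦃i j : D.J⦄ (h : i ≤ j), (D.trans h).vertexMap (x j) = x i)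
    (hfx : ∀ g ∈ C, ∀ j, (D.act j g).hom.vertexMap (x j) = x j) :
    ∃ x : ∀ j, (D.tree j).Vertex, (∀ ⦃i j : D.J⦄ (h : i ≤ j), (D.trans h).vertexMap (x j) = x i) ∧
      ∀ g ∈ C, ∃ N : ℕ, ∀ j, (D.tree j).subdivision.dist (Sum.inl (x j))
        (Sum.inl ((D.act j g).hom.vertexMap (x j))) ≤ N :=
  ⟨x, hx, fun g hg => ⟨0, fun j => by rw [hfx g hg j, SimpleGraph.dist_self]⟩⟩

end VerticialLevelData

end ProfiniteSemiGraph

end Literature.AnabelianGeometry.SemiGraphs
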